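import Summits.QuantumFields.BalabanUV.Beta.NVertexWoundPeriodised
import Summits.QuantumFields.BalabanUV.Beta.CombHId2TorusSym

/-!
# `BalabanUV.Beta.NVertexWoundTorus` — row D1 ∕ (C1), PART 17: **THE WOUND SECOND-ORDER N-FAMILY ON THE TORUS, WORD BY WORD** — the torus matrix
# `perF T (dper T (x z ↦ Σ'_n WN R P j μ y ν (y′ + M′∘n) x z))` (`T = Lc^(j+1)·M′`) is `½•(perF T (W2OfK b b′) + perF T (W2OfK b′ b))`, each `W2OfK` the sum of FOUR torus
# words READ at the N record: the bi-vertex (two `Θ`-columns of `Â := perF T (AN R j)` against `perF T (T2_N^{per,csf} κ u κ′ u′)` — road (H)'s `colN̂·colN̂` shape),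
# the two mixed words (one `Θ`-column, one `Ŝ`-column = the multiplier–multiplier block of `Â` between two coarse points, against `perF T (M2_N^{per,cs} κ u ρ w)`),
# and the response word (`−(Â·D̂_{b′}·Â)`-columns against the first-order tables' torus matrices) — the N twin of `CombHId2TorusRecord` §1 ∕ §3, every socket of
# `CombHId2TorusSym ∕ CombHId2FoldsSlots ∕ CombHId2Torus ∕ CombHId2TorusWords` (chart `K` GENERIC there) discharged by PART 16's letters BY NAME; ONE hypothesis `hM`

WHY.  Road FP g43 (H) `TowerQN2RowCopies.Qprime2_symm_apply_eq_sum_sum_perF_dper_copies` put v5's second-order 𝔔-row's LEFT side in the seam currency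
`(c²·r·r·Σ_full) · Σ_b Σ_{b′} colN̂_a b · (colN̂_{a′} b′ · perF T (dper T (second-bond copy sum of the sym packed table at (b, b′))) (fN (x̄,κ₀)) (z♭,β))`; the RIGHT side is
`perF T (dper T (wound WN♮))`.  PART 16 `dper_tsum_WN` identified `dper T (wound WN)` with `W2SymOfK (AN R j) (Lc^(j+1)) S^per Mt^per T2^{per,csf} M2^{per,cs}`; this file reads
its torus matrix in the four shapes the junction must match (the even half `WN♮` follows by linearity and road (D)'s `perF_trK_apply ∕ perF_sgnK_apply ∕ dper_trK ∕ dper_sgnK`).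
LOCATED for the road successor's `TowerQN2Row`: only the bi-vertex word is of (H)'s `colN̂·colN̂ • (…)` shape; the mixed words carry an `Ŝ`-column and the response word
a triple product — the per-sector table-word hypotheses must be displayed in THESE shapes (journal PROPOSED-1 l.67771, junction flag).

WHAT ([folklore] bookkeeping BY NAME; no `def`, no `def … : Prop`, nothing cited, 0 sorry; notation of the docstrings: `K := AN R j = compChart …`, `N := Lc^(j+1)`,
`S^per κ u := dper M (S_N κ u)`, `Mt^per ρ w := dper M (tabsN.M 0 ρ w)`, `T2^{per,csf}`, `M2^{per,cs}` as in PART 16, `Â := perF M K`, `D̂_b := perF M (dM K N S^per Mt^per b)`):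
§1 bridges `translate_inv_AN`, `periodCov_SN`, `periodCov_MtN`, `periodCov_M2N`; §2 **`perF_dper_tsum_WN`**
(`= perF M (W2SymOfK …)`), **`perF_W2SymOfK_N`** (`= ½•(perF M (W2OfK b b′) + perF M (W2OfK b′ b))`), **`perF_W2OfK_N`** (the four words), **`perF_dM_N`**,
**`perF_vertexOfK_N_apply`** (`Θ`-columns), **`perF_vertexOfM_N_apply`** (`Ŝ`-columns), **`perF_vertex2OfK_N`** (`Θ Θ` — the bi-vertex), **`perF_mixOfK_N`** (`Θ Ŝ` — the mixed
word, either bond order), **`perF_resp_N`** (the response word).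
WHAT THIS IS NOT: not the match against `compVH2Ker ℓˢ 𝓋ˢ 𝓋₂ˢ` (the (C1) table word at order 2, with the lock rows SPEC-54 §5); not the even half; no row of the END wrapper
discharged; nothing of Bałaban's asserted, valued or discharged; 0 estimates; 0∕4 row-D1 binders (hW, hR, D1Tel, D1Rep); ROOT M‴ p325680 ∕ P5c ∕ D6 untouched; NOT (C1),
NOT (T-ID), NOT D1, NEVER «G-an2-4 closed», NOT BetaPertH, NOT continuum, NOT Clay.

HONEST DEPENDENCY (page 1, mandatory): continuum YM on T⁴ ⇐ BetaPertH ∧ nine spine estimates (0/9 proved); BetaPertH ⇐ (D1) ∧ (D4) ∧ CAP+tail;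
G-an2-4 gates asym, D1 and NE2/3/4.  HONEST FRAMING (cell contract, verbatim): «discharging `BetaPertH` makes Bałaban's UV stability UNCONDITIONAL —
a real constructive-QFT result; it is NOT the continuum limit and NOT the Clay problem.»  ABSOLUTE RULE (cell charter, verbatim): «No internally-minted
statement may enter as a cited fact. Every hypothesis is either kernel-proved in this package or a verbatim quotation of a PUBLISHED theorem with page
reference. The manuscript(s) under audit are NOT citable for their own disputed steps — they are the thing under adjudication; programme-internal
(2001/route/tribunal) claims are never citable.»  Row D1 ∕ (C1) OWNER an2 (b2b-balaban-beta-an2) gen 68, 2026-08-27.  No existing file touched.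
-/

noncomputable section

open scoped BigOperators Matrix

namespace Summit.QuantumFields.BalabanUV.Beta.NVertexWoundTorus

open Literature.MathematicalPhysics.QuantumFieldTheory
open Literature.MathematicalPhysics.QuantumFieldTheory.Balaban1983to89
open Literature.MathematicalPhysics.QuantumFieldTheory.Balaban1983to89.Beta
open B4TorusKernel.MultiPeriod (translate translate_apply)
open B6Lemma24Torus (pbox)
open ExpKernelCalculus (MKer Decays BiLoc VertexFamily shiftK)
open AffineAveraging (Site box)
open OneStepResolventKernel (Fib LocStencil)
open OneStepKernelFamily (vertexOfK)
open BalabanCompositeJets (LocStencil₂)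
open BalabanStepW2 (M2Of M2Of_translate)
open SecondOrderResponse (vertexOfM dM K2OfK vertex2OfK mixOfK W2OfK W2SymOfK LocStencilFM)
open Summit.QuantumFields.BalabanUV.Beta.AxialDressingRooted (one_le_of_neZero)
open Summit.QuantumFields.BalabanUV.Beta.SpineRooted (SpureRecOf T2RecOf)
open Summit.QuantumFields.BalabanUV.Beta.CompositeCorrectorDress (compChart)
open Summit.QuantumFields.BalabanUV.Beta.CompositeOneShotJets (tabsComp)
open Summit.QuantumFields.BalabanUV.Beta.CompositeOneShotJetData (Roots Pins AN AN_eq WN)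
open Summit.QuantumFields.BalabanUV.Beta.FP.KernelPeriodisationFib (Idx perF perZ translate_invariant_of_shiftK)
open Summit.QuantumFields.BalabanUV.Beta.FP.KernelPeriodisationFibLoc (dper)
open Summit.QuantumFields.BalabanUV.Beta.FP.TorusGaugeCovariancePairing (wrapPt)
open Summit.QuantumFields.BalabanUV.Beta.CombHId1Letters (perZ_coarse_col_eq_perF periodCov_of_shiftK_cov)
open Summit.QuantumFields.BalabanUV.Beta.CombHId1Sandwich (perF_vertexOfK_dper_apply)
open Summit.QuantumFields.BalabanUV.Beta.CombHId2W2SymSwap (shiftK_pos_of_neg cperiodCov_of_shiftK_cov' fmperiodCov_of_shiftK_cov)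
open Summit.QuantumFields.BalabanUV.Beta.CombHId2Torus (perF_dM_dper perF_vertexOfM_dper_apply perZ_coarse_coarse_eq_perF)
open Summit.QuantumFields.BalabanUV.Beta.CombHId2FoldsSlots (perF_vertex2OfK_csf_per perF_mixOfK_cs_per)
open Summit.QuantumFields.BalabanUV.Beta.CombHId2TorusWords (perF_dM_K2OfK_dper_apply)
open Summit.QuantumFields.BalabanUV.Beta.CombHId2TorusSym (perF_W2OfK_slots perF_W2SymOfK_slots)
open Summit.QuantumFields.BalabanUV.Beta.NVertexWoundPeriodised (decays_AN_family shiftK_AN exists_locStencil_SN SN_translate exists_locStencil₂_T2N T2N_translate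
  exists_locStencilFM_M2N dper_tsum_WN)

variable {Lc : ℕ} [NeZero Lc] (R : Roots Lc) (P : Pins) (j : ℕ) (M : Fin (3 + 1) → ℕ) [∀ μ, NeZero (M μ)] {M' : Fin (3 + 1) → ℕ}

/-! ## §1 Bridges: the sockets of the (C2) torus readings at the N record, in period form -/

section Bridges

omit [∀ μ, NeZero (M μ)] in
/-- [folklore] the N-chart is invariant under every fine period lattice `M = Lc^(j+1)·M′` (PART 16 `shiftK_AN` through gan24-p3's `translate_invariant_of_shiftK`). -/
theorem translate_inv_AN (hM : ∀ i, M i = Lc ^ (j + 1) * M' i) (m x z : Site (3 + 1)) (a b : Fib 3) :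
    AN R j (translate M x m) (translate M z m) a b = AN R j x z a b := by
  rw [AN_eq]
  exact translate_invariant_of_shiftK M (shiftK_pos_of_neg (shiftK_AN R j 0)) (fun i => ⟨M' i, hM i⟩) m x z a b

omit [∀ μ, NeZero (M μ)] in
/-- [folklore] the N-record's pure first-order tables are period covariant on `M` (PART 16 `SN_translate` through C2a's bridge). -/
theorem periodCov_SN (hM : ∀ i, M i = Lc ^ (j + 1) * M' i) (κ : Fin (3 + 1)) (u m x z : Site (3 + 1)) (a b : Fib 3) :
    SpureRecOf 3 (Lc ^ (j + 1)) (tabsComp (j + 1) (one_le_of_neZero Lc) R.hr (P.cM (j + 1))).V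
              (tabsComp (j + 1) (one_le_of_neZero Lc) R.hr (P.cM (j + 1))).H (fun _ => compChart R.rc Lc (j + 1) (R.s (j + 1)) (Lc ^ (j + 1)))
              (P.cE (j + 1)) (P.cVH (j + 1)) (P.cΛ (j + 1)) 0 κ (translate M u m) (translate M x m) (translate M z m) a b
      = SpureRecOf 3 (Lc ^ (j + 1)) (tabsComp (j + 1) (one_le_of_neZero Lc) R.hr (P.cM (j + 1))).V
              (tabsComp (j + 1) (one_le_of_neZero Lc) R.hr (P.cM (j + 1))).H (fun _ => compChart R.rc Lc (j + 1) (R.s (j + 1)) (Lc ^ (j + 1)))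
              (P.cE (j + 1)) (P.cVH (j + 1)) (P.cΛ (j + 1)) 0 κ u x z a b :=
  periodCov_of_shiftK_cov M (S := SpureRecOf 3 (Lc ^ (j + 1)) (tabsComp (j + 1) (one_le_of_neZero Lc) R.hr (P.cM (j + 1))).V
              (tabsComp (j + 1) (one_le_of_neZero Lc) R.hr (P.cM (j + 1))).H (fun _ => compChart R.rc Lc (j + 1) (R.s (j + 1)) (Lc ^ (j + 1)))
              (P.cE (j + 1)) (P.cVH (j + 1)) (P.cΛ (j + 1)) 0) (fun κ u t => SN_translate R P j 0 κ u t) (fun i => ⟨M' i, hM i⟩) κ u m x z a b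

omit [∀ μ, NeZero (M μ)] [NeZero Lc] in
/-- [folklore] the N-record's multiplier tables are `M′`-period covariant on `M = Lc^(j+1)·M′` ((TM) through `cperiodCov_of_shiftK_cov′`). -/
theorem periodCov_MtN (hLc : 1 ≤ Lc) (hM : ∀ i, M i = Lc ^ (j + 1) * M' i) (ρ : Fin (3 + 1)) (w m x z : Site (3 + 1)) (a b : Fib 3) :
    (tabsComp (j + 1) hLc R.hr (P.cM (j + 1))).M 0 ρ (translate M' w m) (translate M x m) (translate M z m) a b
      = (tabsComp (j + 1) hLc R.hr (P.cM (j + 1))).M 0 ρ w x z a b :=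
  cperiodCov_of_shiftK_cov' M hM (fun ρ w t => (tabsComp (j + 1) hLc R.hr (P.cM (j + 1))).hMt 0 ρ w t) ρ w m x z a b

omit [∀ μ, NeZero (M μ)] [NeZero Lc] in
/-- [folklore] the `(Tmix)` bridge at the N record: `M2Of 3 (Lc^(j+1)) mixFF_N 0` is jointly period covariant (`fmperiodCov_of_shiftK_cov` on lit `M2Of_translate (Tmix)`). -/
theorem periodCov_M2N (hLc : 1 ≤ Lc) (hM : ∀ i, M i = Lc ^ (j + 1) * M' i) (κ : Fin (3 + 1)) (u : Site (3 + 1)) (ρ : Fin (3 + 1)) (w m x z : Site (3 + 1)) (a c : Fib 3) :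
    M2Of 3 (Lc ^ (j + 1)) (tabsComp (j + 1) hLc R.hr (P.cM (j + 1))).mixFF 0 κ (translate M u m) ρ (translate M' w m) (translate M x m) (translate M z m) a c
      = M2Of 3 (Lc ^ (j + 1)) (tabsComp (j + 1) hLc R.hr (P.cM (j + 1))).mixFF 0 κ u ρ w x z a c :=
  fmperiodCov_of_shiftK_cov M hM (M2Of_translate (Lc := Lc ^ (j + 1)) (tabsComp (j + 1) hLc R.hr (P.cM (j + 1))).hmixt 0) κ u ρ w m x z a c

end Bridges

/-! ## §2 The torus readings at the N record -/

section Torus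

variable [∀ μ, NeZero (M' μ)]

omit [∀ μ, NeZero (M' μ)] in
/-- [folklore] **`perF_dper_tsum_WN`** — the torus matrix of the wound N slot IS `perF M (W2SymOfK (AN R j) …)` (PART 16 `dper_tsum_WN` under `perF M`). -/
theorem perF_dper_tsum_WN (hM : ∀ i, M i = Lc ^ (j + 1) * M' i) (μ : Fin (3 + 1)) (y : Site (3 + 1)) (ν : Fin (3 + 1)) (y' : Site (3 + 1)) :
    perF M (dper M (fun x z a c => ∑' n : Site (3 + 1), WN R P j μ y ν (translate M' y' n) x z a c))
      = perF M (W2SymOfK (AN R j) (Lc ^ (j + 1)) (fun κ u => dper M (SpureRecOf 3 (Lc ^ (j + 1)) (tabsComp (j + 1) (one_le_of_neZero Lc) R.hr (P.cM (j + 1))).V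
              (tabsComp (j + 1) (one_le_of_neZero Lc) R.hr (P.cM (j + 1))).H (fun _ => compChart R.rc Lc (j + 1) (R.s (j + 1)) (Lc ^ (j + 1)))
              (P.cE (j + 1)) (P.cVH (j + 1)) (P.cΛ (j + 1)) 0 κ u)) (fun ρ w => dper M ((tabsComp (j + 1) (one_le_of_neZero Lc) R.hr (P.cM (j + 1))).M 0 ρ w))
          (fun κ u κ' u' => dper M (fun x z a c => ∑' n : Site (3 + 1),
              T2RecOf 3 (Lc ^ (j + 1)) (fun _ => compChart R.rc Lc (j + 1) (R.s (j + 1)) (Lc ^ (j + 1)))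
              (SpureRecOf 3 (Lc ^ (j + 1)) (tabsComp (j + 1) (one_le_of_neZero Lc) R.hr (P.cM (j + 1))).V
              (tabsComp (j + 1) (one_le_of_neZero Lc) R.hr (P.cM (j + 1))).H (fun _ => compChart R.rc Lc (j + 1) (R.s (j + 1)) (Lc ^ (j + 1)))
              (P.cE (j + 1)) (P.cVH (j + 1)) (P.cΛ (j + 1)))
              (tabsComp (j + 1) (one_le_of_neZero Lc) R.hr (P.cM (j + 1))).M (P.cE₂ (j + 1)) (P.cB (j + 1)) (P.T (j + 1))
              (tabsComp (j + 1) (one_le_of_neZero Lc) R.hr (P.cM (j + 1))).vh₂S (tabsComp (j + 1) (one_le_of_neZero Lc) R.hr (P.cM (j + 1))).mixFF 0 κ u κ' (translate M u' n) x z a c))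
          (fun κ u ρ w => dper M (fun x z a c => ∑' n : Site (3 + 1),
              M2Of 3 (Lc ^ (j + 1)) (tabsComp (j + 1) (one_le_of_neZero Lc) R.hr (P.cM (j + 1))).mixFF 0 κ u ρ (translate M' w n) x z a c)) μ y ν y') := by
  rw [dper_tsum_WN R P j M hM μ y ν y']

/-- [folklore] **`Ŵ` SPLITS**: `perF M (W2SymOfK (AN R j) N S^per Mt^per T2^{per,csf} M2^{per,cs} μ y ν y′) = ½ • (perF M (W2OfK … μ y ν y′) + perF M (W2OfK … ν y′ μ y))`
(`CombHId2TorusSym.perF_W2SymOfK_slots` at the N record). -/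
theorem perF_W2SymOfK_N (hM : ∀ i, M i = Lc ^ (j + 1) * M' i) (μ : Fin (3 + 1)) (y : Site (3 + 1)) (ν : Fin (3 + 1)) (y' : Site (3 + 1)) :
    perF M (W2SymOfK (AN R j) (Lc ^ (j + 1)) (fun κ u => dper M (SpureRecOf 3 (Lc ^ (j + 1)) (tabsComp (j + 1) (one_le_of_neZero Lc) R.hr (P.cM (j + 1))).V
              (tabsComp (j + 1) (one_le_of_neZero Lc) R.hr (P.cM (j + 1))).H (fun _ => compChart R.rc Lc (j + 1) (R.s (j + 1)) (Lc ^ (j + 1)))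
              (P.cE (j + 1)) (P.cVH (j + 1)) (P.cΛ (j + 1)) 0 κ u)) (fun ρ w => dper M ((tabsComp (j + 1) (one_le_of_neZero Lc) R.hr (P.cM (j + 1))).M 0 ρ w))
          (fun κ u κ' u' => dper M (fun x z a c => ∑' n : Site (3 + 1),
              T2RecOf 3 (Lc ^ (j + 1)) (fun _ => compChart R.rc Lc (j + 1) (R.s (j + 1)) (Lc ^ (j + 1)))
              (SpureRecOf 3 (Lc ^ (j + 1)) (tabsComp (j + 1) (one_le_of_neZero Lc) R.hr (P.cM (j + 1))).V
              (tabsComp (j + 1) (one_le_of_neZero Lc) R.hr (P.cM (j + 1))).H (fun _ => compChart R.rc Lc (j + 1) (R.s (j + 1)) (Lc ^ (j + 1)))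
              (P.cE (j + 1)) (P.cVH (j + 1)) (P.cΛ (j + 1)))
              (tabsComp (j + 1) (one_le_of_neZero Lc) R.hr (P.cM (j + 1))).M (P.cE₂ (j + 1)) (P.cB (j + 1)) (P.T (j + 1))
              (tabsComp (j + 1) (one_le_of_neZero Lc) R.hr (P.cM (j + 1))).vh₂S (tabsComp (j + 1) (one_le_of_neZero Lc) R.hr (P.cM (j + 1))).mixFF 0 κ u κ' (translate M u' n) x z a c))
          (fun κ u ρ w => dper M (fun x z a c => ∑' n : Site (3 + 1),
              M2Of 3 (Lc ^ (j + 1)) (tabsComp (j + 1) (one_le_of_neZero Lc) R.hr (P.cM (j + 1))).mixFF 0 κ u ρ (translate M' w n) x z a c)) μ y ν y')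
      = (1 / 2 : ℝ) • (perF M (W2OfK (AN R j) (Lc ^ (j + 1)) (fun κ u => dper M (SpureRecOf 3 (Lc ^ (j + 1)) (tabsComp (j + 1) (one_le_of_neZero Lc) R.hr (P.cM (j + 1))).V
              (tabsComp (j + 1) (one_le_of_neZero Lc) R.hr (P.cM (j + 1))).H (fun _ => compChart R.rc Lc (j + 1) (R.s (j + 1)) (Lc ^ (j + 1)))
              (P.cE (j + 1)) (P.cVH (j + 1)) (P.cΛ (j + 1)) 0 κ u)) (fun ρ w => dper M ((tabsComp (j + 1) (one_le_of_neZero Lc) R.hr (P.cM (j + 1))).M 0 ρ w))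
            (fun κ u κ' u' => dper M (fun x z a c => ∑' n : Site (3 + 1),
              T2RecOf 3 (Lc ^ (j + 1)) (fun _ => compChart R.rc Lc (j + 1) (R.s (j + 1)) (Lc ^ (j + 1)))
              (SpureRecOf 3 (Lc ^ (j + 1)) (tabsComp (j + 1) (one_le_of_neZero Lc) R.hr (P.cM (j + 1))).V
              (tabsComp (j + 1) (one_le_of_neZero Lc) R.hr (P.cM (j + 1))).H (fun _ => compChart R.rc Lc (j + 1) (R.s (j + 1)) (Lc ^ (j + 1)))
              (P.cE (j + 1)) (P.cVH (j + 1)) (P.cΛ (j + 1)))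
              (tabsComp (j + 1) (one_le_of_neZero Lc) R.hr (P.cM (j + 1))).M (P.cE₂ (j + 1)) (P.cB (j + 1)) (P.T (j + 1))
              (tabsComp (j + 1) (one_le_of_neZero Lc) R.hr (P.cM (j + 1))).vh₂S (tabsComp (j + 1) (one_le_of_neZero Lc) R.hr (P.cM (j + 1))).mixFF 0 κ u κ' (translate M u' n) x z a c))
            (fun κ u ρ w => dper M (fun x z a c => ∑' n : Site (3 + 1),
              M2Of 3 (Lc ^ (j + 1)) (tabsComp (j + 1) (one_le_of_neZero Lc) R.hr (P.cM (j + 1))).mixFF 0 κ u ρ (translate M' w n) x z a c)) μ y ν y')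
          + perF M (W2OfK (AN R j) (Lc ^ (j + 1)) (fun κ u => dper M (SpureRecOf 3 (Lc ^ (j + 1)) (tabsComp (j + 1) (one_le_of_neZero Lc) R.hr (P.cM (j + 1))).V
              (tabsComp (j + 1) (one_le_of_neZero Lc) R.hr (P.cM (j + 1))).H (fun _ => compChart R.rc Lc (j + 1) (R.s (j + 1)) (Lc ^ (j + 1)))
              (P.cE (j + 1)) (P.cVH (j + 1)) (P.cΛ (j + 1)) 0 κ u)) (fun ρ w => dper M ((tabsComp (j + 1) (one_le_of_neZero Lc) R.hr (P.cM (j + 1))).M 0 ρ w))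
            (fun κ u κ' u' => dper M (fun x z a c => ∑' n : Site (3 + 1),
              T2RecOf 3 (Lc ^ (j + 1)) (fun _ => compChart R.rc Lc (j + 1) (R.s (j + 1)) (Lc ^ (j + 1)))
              (SpureRecOf 3 (Lc ^ (j + 1)) (tabsComp (j + 1) (one_le_of_neZero Lc) R.hr (P.cM (j + 1))).V
              (tabsComp (j + 1) (one_le_of_neZero Lc) R.hr (P.cM (j + 1))).H (fun _ => compChart R.rc Lc (j + 1) (R.s (j + 1)) (Lc ^ (j + 1)))
              (P.cE (j + 1)) (P.cVH (j + 1)) (P.cΛ (j + 1)))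
              (tabsComp (j + 1) (one_le_of_neZero Lc) R.hr (P.cM (j + 1))).M (P.cE₂ (j + 1)) (P.cB (j + 1)) (P.T (j + 1))
              (tabsComp (j + 1) (one_le_of_neZero Lc) R.hr (P.cM (j + 1))).vh₂S (tabsComp (j + 1) (one_le_of_neZero Lc) R.hr (P.cM (j + 1))).mixFF 0 κ u κ' (translate M u' n) x z a c))
            (fun κ u ρ w => dper M (fun x z a c => ∑' n : Site (3 + 1),
              M2Of 3 (Lc ^ (j + 1)) (tabsComp (j + 1) (one_le_of_neZero Lc) R.hr (P.cM (j + 1))).mixFF 0 κ u ρ (translate M' w n) x z a c)) ν y' μ y)) := by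
  obtain ⟨δG, CG, hδG, -, hG⟩ := decays_AN_family R j 0
  obtain ⟨CS, δS, hδS, hS⟩ := exists_locStencil_SN R P j 0
  obtain ⟨CM, δM, hδM, hMloc⟩ := (tabsComp (j + 1) (one_le_of_neZero Lc) R.hr (P.cM (j + 1))).hM 0
  obtain ⟨C₂, δ₂, hδ₂, hS₂⟩ := exists_locStencil₂_T2N R P j 0
  obtain ⟨Cm, δm, hδm, hM₂⟩ := exists_locStencilFM_M2N R P j (one_le_of_neZero Lc) 0
  have h := perF_W2SymOfK_slots M hM (translate_inv_AN R j M hM) (by rw [AN_eq]; exact hG) hδG (periodCov_SN R P j M hM) hS hδS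
    (periodCov_MtN R P j M (one_le_of_neZero Lc) hM) hMloc hδM (T2N_translate R P j 0) hS₂ hδ₂ (periodCov_M2N R P j M (one_le_of_neZero Lc) hM) hM₂ hδm μ y ν y'
  exact h

/-- [folklore] **THE FOUR WORDS** at the N record: `perF M (W2OfK (AN R j) N S^per Mt^per T2^{per,csf} M2^{per,cs} μ y ν y′) = perF M (vertex2OfK …) + perF M (mixOfK … μ y ν y′)
+ perF M (mixOfK … ν y′ μ y) + perF M (dM (K2OfK … ν y′) N S^per Mt^per μ y)` (`CombHId2TorusSym.perF_W2OfK_slots`). -/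
theorem perF_W2OfK_N (hM : ∀ i, M i = Lc ^ (j + 1) * M' i) (μ : Fin (3 + 1)) (y : Site (3 + 1)) (ν : Fin (3 + 1)) (y' : Site (3 + 1)) :
    perF M (W2OfK (AN R j) (Lc ^ (j + 1)) (fun κ u => dper M (SpureRecOf 3 (Lc ^ (j + 1)) (tabsComp (j + 1) (one_le_of_neZero Lc) R.hr (P.cM (j + 1))).V
              (tabsComp (j + 1) (one_le_of_neZero Lc) R.hr (P.cM (j + 1))).H (fun _ => compChart R.rc Lc (j + 1) (R.s (j + 1)) (Lc ^ (j + 1)))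
              (P.cE (j + 1)) (P.cVH (j + 1)) (P.cΛ (j + 1)) 0 κ u)) (fun ρ w => dper M ((tabsComp (j + 1) (one_le_of_neZero Lc) R.hr (P.cM (j + 1))).M 0 ρ w))
            (fun κ u κ' u' => dper M (fun x z a c => ∑' n : Site (3 + 1),
              T2RecOf 3 (Lc ^ (j + 1)) (fun _ => compChart R.rc Lc (j + 1) (R.s (j + 1)) (Lc ^ (j + 1)))
              (SpureRecOf 3 (Lc ^ (j + 1)) (tabsComp (j + 1) (one_le_of_neZero Lc) R.hr (P.cM (j + 1))).V
              (tabsComp (j + 1) (one_le_of_neZero Lc) R.hr (P.cM (j + 1))).H (fun _ => compChart R.rc Lc (j + 1) (R.s (j + 1)) (Lc ^ (j + 1)))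
              (P.cE (j + 1)) (P.cVH (j + 1)) (P.cΛ (j + 1)))
              (tabsComp (j + 1) (one_le_of_neZero Lc) R.hr (P.cM (j + 1))).M (P.cE₂ (j + 1)) (P.cB (j + 1)) (P.T (j + 1))
              (tabsComp (j + 1) (one_le_of_neZero Lc) R.hr (P.cM (j + 1))).vh₂S (tabsComp (j + 1) (one_le_of_neZero Lc) R.hr (P.cM (j + 1))).mixFF 0 κ u κ' (translate M u' n) x z a c))
            (fun κ u ρ w => dper M (fun x z a c => ∑' n : Site (3 + 1),
              M2Of 3 (Lc ^ (j + 1)) (tabsComp (j + 1) (one_le_of_neZero Lc) R.hr (P.cM (j + 1))).mixFF 0 κ u ρ (translate M' w n) x z a c)) μ y ν y')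
      = perF M (vertex2OfK (AN R j) (Lc ^ (j + 1)) (fun κ u κ' u' => dper M (fun x z a c => ∑' n : Site (3 + 1),
              T2RecOf 3 (Lc ^ (j + 1)) (fun _ => compChart R.rc Lc (j + 1) (R.s (j + 1)) (Lc ^ (j + 1)))
              (SpureRecOf 3 (Lc ^ (j + 1)) (tabsComp (j + 1) (one_le_of_neZero Lc) R.hr (P.cM (j + 1))).V
              (tabsComp (j + 1) (one_le_of_neZero Lc) R.hr (P.cM (j + 1))).H (fun _ => compChart R.rc Lc (j + 1) (R.s (j + 1)) (Lc ^ (j + 1)))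
              (P.cE (j + 1)) (P.cVH (j + 1)) (P.cΛ (j + 1)))
              (tabsComp (j + 1) (one_le_of_neZero Lc) R.hr (P.cM (j + 1))).M (P.cE₂ (j + 1)) (P.cB (j + 1)) (P.T (j + 1))
              (tabsComp (j + 1) (one_le_of_neZero Lc) R.hr (P.cM (j + 1))).vh₂S (tabsComp (j + 1) (one_le_of_neZero Lc) R.hr (P.cM (j + 1))).mixFF 0 κ u κ' (translate M u' n) x z a c)) μ y ν y')
        + perF M (mixOfK (AN R j) (Lc ^ (j + 1))
            (fun κ u ρ w => dper M (fun x z a c => ∑' n : Site (3 + 1),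
              M2Of 3 (Lc ^ (j + 1)) (tabsComp (j + 1) (one_le_of_neZero Lc) R.hr (P.cM (j + 1))).mixFF 0 κ u ρ (translate M' w n) x z a c)) μ y ν y')
        + perF M (mixOfK (AN R j) (Lc ^ (j + 1))
            (fun κ u ρ w => dper M (fun x z a c => ∑' n : Site (3 + 1),
              M2Of 3 (Lc ^ (j + 1)) (tabsComp (j + 1) (one_le_of_neZero Lc) R.hr (P.cM (j + 1))).mixFF 0 κ u ρ (translate M' w n) x z a c)) ν y' μ y)
        + perF M (dM (K2OfK (AN R j) (Lc ^ (j + 1)) (fun κ u => dper M (SpureRecOf 3 (Lc ^ (j + 1)) (tabsComp (j + 1) (one_le_of_neZero Lc) R.hr (P.cM (j + 1))).V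
              (tabsComp (j + 1) (one_le_of_neZero Lc) R.hr (P.cM (j + 1))).H (fun _ => compChart R.rc Lc (j + 1) (R.s (j + 1)) (Lc ^ (j + 1)))
              (P.cE (j + 1)) (P.cVH (j + 1)) (P.cΛ (j + 1)) 0 κ u)) (fun ρ w => dper M ((tabsComp (j + 1) (one_le_of_neZero Lc) R.hr (P.cM (j + 1))).M 0 ρ w)) ν y') (Lc ^ (j + 1))
            (fun κ u => dper M (SpureRecOf 3 (Lc ^ (j + 1)) (tabsComp (j + 1) (one_le_of_neZero Lc) R.hr (P.cM (j + 1))).V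
              (tabsComp (j + 1) (one_le_of_neZero Lc) R.hr (P.cM (j + 1))).H (fun _ => compChart R.rc Lc (j + 1) (R.s (j + 1)) (Lc ^ (j + 1)))
              (P.cE (j + 1)) (P.cVH (j + 1)) (P.cΛ (j + 1)) 0 κ u)) (fun ρ w => dper M ((tabsComp (j + 1) (one_le_of_neZero Lc) R.hr (P.cM (j + 1))).M 0 ρ w)) μ y) := by
  obtain ⟨δG, CG, hδG, -, hG⟩ := decays_AN_family R j 0
  obtain ⟨CS, δS, hδS, hS⟩ := exists_locStencil_SN R P j 0
  obtain ⟨CM, δM, hδM, hMloc⟩ := (tabsComp (j + 1) (one_le_of_neZero Lc) R.hr (P.cM (j + 1))).hM 0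
  obtain ⟨C₂, δ₂, hδ₂, hS₂⟩ := exists_locStencil₂_T2N R P j 0
  obtain ⟨Cm, δm, hδm, hM₂⟩ := exists_locStencilFM_M2N R P j (one_le_of_neZero Lc) 0
  have h := perF_W2OfK_slots M hM (translate_inv_AN R j M hM) (by rw [AN_eq]; exact hG) hδG (periodCov_SN R P j M hM) hS hδS
    (periodCov_MtN R P j M (one_le_of_neZero Lc) hM) hMloc hδM (T2N_translate R P j 0) hS₂ hδ₂ (periodCov_M2N R P j M (one_le_of_neZero Lc) hM) hM₂ hδm μ y ν y'
  exact h

omit [∀ μ, NeZero (M' μ)] in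
/-- [folklore] `D̂_b = perF M (vertexOfK K N S^per b) + perF M (vertexOfM K N Mt^per b)` at the N record (`CombHId2Torus.perF_dM_dper`). -/
theorem perF_dM_N (hM : ∀ i, M i = Lc ^ (j + 1) * M' i) (μ : Fin (3 + 1)) (y : Site (3 + 1)) :
    perF M (dM (AN R j) (Lc ^ (j + 1)) (fun κ u => dper M (SpureRecOf 3 (Lc ^ (j + 1)) (tabsComp (j + 1) (one_le_of_neZero Lc) R.hr (P.cM (j + 1))).V
              (tabsComp (j + 1) (one_le_of_neZero Lc) R.hr (P.cM (j + 1))).H (fun _ => compChart R.rc Lc (j + 1) (R.s (j + 1)) (Lc ^ (j + 1)))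
              (P.cE (j + 1)) (P.cVH (j + 1)) (P.cΛ (j + 1)) 0 κ u)) (fun ρ w => dper M ((tabsComp (j + 1) (one_le_of_neZero Lc) R.hr (P.cM (j + 1))).M 0 ρ w)) μ y)
      = perF M (vertexOfK (AN R j) (Lc ^ (j + 1)) (fun κ u => dper M (SpureRecOf 3 (Lc ^ (j + 1)) (tabsComp (j + 1) (one_le_of_neZero Lc) R.hr (P.cM (j + 1))).V
              (tabsComp (j + 1) (one_le_of_neZero Lc) R.hr (P.cM (j + 1))).H (fun _ => compChart R.rc Lc (j + 1) (R.s (j + 1)) (Lc ^ (j + 1)))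
              (P.cE (j + 1)) (P.cVH (j + 1)) (P.cΛ (j + 1)) 0 κ u)) μ y)
        + perF M (vertexOfM (AN R j) (Lc ^ (j + 1)) (fun ρ w => dper M ((tabsComp (j + 1) (one_le_of_neZero Lc) R.hr (P.cM (j + 1))).M 0 ρ w)) μ y) := by
  obtain ⟨δG, CG, hδG, -, hG⟩ := decays_AN_family R j 0
  obtain ⟨CS, δS, hδS, hS⟩ := exists_locStencil_SN R P j 0
  obtain ⟨CM, δM, hδM, hMloc⟩ := (tabsComp (j + 1) (one_le_of_neZero Lc) R.hr (P.cM (j + 1))).hM 0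
  have h := perF_dM_dper M hM (translate_inv_AN R j M hM) (by rw [AN_eq]; exact hG) hδG (periodCov_SN R P j M hM) hS hδS
    (periodCov_MtN R P j M (one_le_of_neZero Lc) hM) hMloc hδM μ y
  exact h

omit [∀ μ, NeZero (M' μ)] in
/-- [folklore] **the `Θ`-column reading of the first field vertex at the N record**:
`perF M (vertexOfK K N S^per μ y) P Q = Σ_{u∈pbox M,κ} Â((u, inl κ),(wrapPt M (N•y), inr μ)) · perF M (S^per κ u) P Q` (C2b `perF_vertexOfK_dper_apply` + C2a `perZ_coarse_col_eq_perF`). -/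
theorem perF_vertexOfK_N_apply (hM : ∀ i, M i = Lc ^ (j + 1) * M' i) (μ : Fin (3 + 1)) (y : Site (3 + 1)) (X Z : Idx M (Fib 3)) :
    perF M (vertexOfK (AN R j) (Lc ^ (j + 1)) (fun κ u => dper M (SpureRecOf 3 (Lc ^ (j + 1)) (tabsComp (j + 1) (one_le_of_neZero Lc) R.hr (P.cM (j + 1))).V
              (tabsComp (j + 1) (one_le_of_neZero Lc) R.hr (P.cM (j + 1))).H (fun _ => compChart R.rc Lc (j + 1) (R.s (j + 1)) (Lc ^ (j + 1)))
              (P.cE (j + 1)) (P.cVH (j + 1)) (P.cΛ (j + 1)) 0 κ u)) μ y) X Z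
      = ∑ u : ↥(pbox M), ∑ κ : Fin (3 + 1), perF M (AN R j) (u, Sum.inl κ) (wrapPt M (((Lc ^ (j + 1) : ℕ) : ℤ) • y), Sum.inr μ)
          * perF M (dper M (SpureRecOf 3 (Lc ^ (j + 1)) (tabsComp (j + 1) (one_le_of_neZero Lc) R.hr (P.cM (j + 1))).V
              (tabsComp (j + 1) (one_le_of_neZero Lc) R.hr (P.cM (j + 1))).H (fun _ => compChart R.rc Lc (j + 1) (R.s (j + 1)) (Lc ^ (j + 1)))
              (P.cE (j + 1)) (P.cVH (j + 1)) (P.cΛ (j + 1)) 0 κ (u : Site (3 + 1)))) X Z := by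
  obtain ⟨δG, CG, hδG, -, hG⟩ := decays_AN_family R j 0
  obtain ⟨CS, δS, hδS, hS⟩ := exists_locStencil_SN R P j 0
  rw [perF_vertexOfK_dper_apply M (translate_inv_AN R j M hM) (by rw [AN_eq]; exact hG) hδG (periodCov_SN R P j M hM) hS hδS μ y X Z]
  simp only [perZ_coarse_col_eq_perF]

/-- [folklore] **the `Ŝ`-column reading of the multiplier vertex at the N record**:
`perF M (vertexOfM K N Mt^per μ y) P Q = Σ_{w∈pbox M′,ρ} Â((wrapPt M (N•w), inr ρ),(wrapPt M (N•y), inr μ)) · perF M (Mt^per ρ w) P Q` (`CombHId2Torus` §4). -/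
theorem perF_vertexOfM_N_apply (hM : ∀ i, M i = Lc ^ (j + 1) * M' i) (μ : Fin (3 + 1)) (y : Site (3 + 1)) (X Z : Idx M (Fib 3)) :
    perF M (vertexOfM (AN R j) (Lc ^ (j + 1)) (fun ρ w => dper M ((tabsComp (j + 1) (one_le_of_neZero Lc) R.hr (P.cM (j + 1))).M 0 ρ w)) μ y) X Z
      = ∑ w : ↥(pbox M'), ∑ ρ : Fin (3 + 1),
          perF M (AN R j) (wrapPt M (((Lc ^ (j + 1) : ℕ) : ℤ) • (w : Site (3 + 1))), Sum.inr ρ) (wrapPt M (((Lc ^ (j + 1) : ℕ) : ℤ) • y), Sum.inr μ)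
            * perF M (dper M ((tabsComp (j + 1) (one_le_of_neZero Lc) R.hr (P.cM (j + 1))).M 0 ρ (w : Site (3 + 1)))) X Z := by
  obtain ⟨δG, CG, hδG, -, hG⟩ := decays_AN_family R j 0
  obtain ⟨CM, δM, hδM, hMloc⟩ := (tabsComp (j + 1) (one_le_of_neZero Lc) R.hr (P.cM (j + 1))).hM 0
  rw [perF_vertexOfM_dper_apply M hM (translate_inv_AN R j M hM) (by rw [AN_eq]; exact hG) hδG (periodCov_MtN R P j M (one_le_of_neZero Lc) hM) hMloc hδM μ y X Z]
  simp only [perZ_coarse_coarse_eq_perF M (translate_inv_AN R j M hM)]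

omit [∀ μ, NeZero (M' μ)] in
/-- [folklore] **THE BI-VERTEX WORD AT THE N RECORD** (road (H)'s `colN̂·colN̂` shape): `perF M (vertex2OfK K N T2^{per,csf} μ y ν y′) P Q
= Σ_{u,κ} Σ_{u′,κ′} Â((u, inl κ),(wrapPt M (N•y), inr μ)) · (Â((u′, inl κ′),(wrapPt M (N•y′), inr ν)) · perF M (T2^{per,csf} κ u κ′ u′) P Q)` (`CombHId2FoldsSlots.perF_vertex2OfK_csf_per`). -/
theorem perF_vertex2OfK_N (hM : ∀ i, M i = Lc ^ (j + 1) * M' i) (μ : Fin (3 + 1)) (y : Site (3 + 1)) (ν : Fin (3 + 1)) (y' : Site (3 + 1)) (X Z : Idx M (Fib 3)) :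
    perF M (vertex2OfK (AN R j) (Lc ^ (j + 1)) (fun κ u κ' u' => dper M (fun x z a c => ∑' n : Site (3 + 1),
              T2RecOf 3 (Lc ^ (j + 1)) (fun _ => compChart R.rc Lc (j + 1) (R.s (j + 1)) (Lc ^ (j + 1)))
              (SpureRecOf 3 (Lc ^ (j + 1)) (tabsComp (j + 1) (one_le_of_neZero Lc) R.hr (P.cM (j + 1))).V
              (tabsComp (j + 1) (one_le_of_neZero Lc) R.hr (P.cM (j + 1))).H (fun _ => compChart R.rc Lc (j + 1) (R.s (j + 1)) (Lc ^ (j + 1)))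
              (P.cE (j + 1)) (P.cVH (j + 1)) (P.cΛ (j + 1)))
              (tabsComp (j + 1) (one_le_of_neZero Lc) R.hr (P.cM (j + 1))).M (P.cE₂ (j + 1)) (P.cB (j + 1)) (P.T (j + 1))
              (tabsComp (j + 1) (one_le_of_neZero Lc) R.hr (P.cM (j + 1))).vh₂S (tabsComp (j + 1) (one_le_of_neZero Lc) R.hr (P.cM (j + 1))).mixFF 0 κ u κ' (translate M u' n) x z a c)) μ y ν y') X Z
      = ∑ u : ↥(pbox M), ∑ κ : Fin (3 + 1), ∑ u' : ↥(pbox M), ∑ κ' : Fin (3 + 1),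
          perF M (AN R j) (u, Sum.inl κ) (wrapPt M (((Lc ^ (j + 1) : ℕ) : ℤ) • y), Sum.inr μ)
            * (perF M (AN R j) (u', Sum.inl κ') (wrapPt M (((Lc ^ (j + 1) : ℕ) : ℤ) • y'), Sum.inr ν)
                * perF M (dper M (fun x z a c => ∑' n : Site (3 + 1), T2RecOf 3 (Lc ^ (j + 1)) (fun _ => compChart R.rc Lc (j + 1) (R.s (j + 1)) (Lc ^ (j + 1)))
              (SpureRecOf 3 (Lc ^ (j + 1)) (tabsComp (j + 1) (one_le_of_neZero Lc) R.hr (P.cM (j + 1))).V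
              (tabsComp (j + 1) (one_le_of_neZero Lc) R.hr (P.cM (j + 1))).H (fun _ => compChart R.rc Lc (j + 1) (R.s (j + 1)) (Lc ^ (j + 1)))
              (P.cE (j + 1)) (P.cVH (j + 1)) (P.cΛ (j + 1)))
              (tabsComp (j + 1) (one_le_of_neZero Lc) R.hr (P.cM (j + 1))).M (P.cE₂ (j + 1)) (P.cB (j + 1)) (P.T (j + 1))
              (tabsComp (j + 1) (one_le_of_neZero Lc) R.hr (P.cM (j + 1))).vh₂S (tabsComp (j + 1) (one_le_of_neZero Lc) R.hr (P.cM (j + 1))).mixFF 0 κ (u : Site (3 + 1)) κ' (translate M (u' : Site (3 + 1)) n) x z a c)) X Z) := by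
  obtain ⟨δG, CG, hδG, -, hG⟩ := decays_AN_family R j 0
  obtain ⟨C₂, δ₂, hδ₂, hS₂⟩ := exists_locStencil₂_T2N R P j 0
  exact perF_vertex2OfK_csf_per M hM (translate_inv_AN R j M hM) (by rw [AN_eq]; exact hG) hδG (T2N_translate R P j 0) hS₂ hδ₂ μ y ν y' X Z

/-- [folklore] **THE MIXED WORD AT THE N RECORD** (either bond order; ONE `Θ`-column, ONE `Ŝ`-column): `perF M (mixOfK K N M2^{per,cs} μ y ν y′) P Q
= Σ_{u,κ} Σ_{w∈pbox M′,ρ} Â((u, inl κ),(wrapPt M (N•y), inr μ)) · (Â((wrapPt M (N•w), inr ρ),(wrapPt M (N•y′), inr ν)) · perF M (M2^{per,cs} κ u ρ w) P Q)` (`CombHId2FoldsSlots.perF_mixOfK_cs_per`). -/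
theorem perF_mixOfK_N (hM : ∀ i, M i = Lc ^ (j + 1) * M' i) (μ : Fin (3 + 1)) (y : Site (3 + 1)) (ν : Fin (3 + 1)) (y' : Site (3 + 1)) (X Z : Idx M (Fib 3)) :
    perF M (mixOfK (AN R j) (Lc ^ (j + 1)) (fun κ u ρ w => dper M (fun x z a c => ∑' n : Site (3 + 1),
              M2Of 3 (Lc ^ (j + 1)) (tabsComp (j + 1) (one_le_of_neZero Lc) R.hr (P.cM (j + 1))).mixFF 0 κ u ρ (translate M' w n) x z a c)) μ y ν y') X Z
      = ∑ u : ↥(pbox M), ∑ κ : Fin (3 + 1), ∑ w : ↥(pbox M'), ∑ ρ : Fin (3 + 1),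
          perF M (AN R j) (u, Sum.inl κ) (wrapPt M (((Lc ^ (j + 1) : ℕ) : ℤ) • y), Sum.inr μ)
            * (perF M (AN R j) (wrapPt M (((Lc ^ (j + 1) : ℕ) : ℤ) • (w : Site (3 + 1))), Sum.inr ρ) (wrapPt M (((Lc ^ (j + 1) : ℕ) : ℤ) • y'), Sum.inr ν)
                * perF M (dper M (fun x z a c => ∑' n : Site (3 + 1), M2Of 3 (Lc ^ (j + 1)) (tabsComp (j + 1) (one_le_of_neZero Lc) R.hr (P.cM (j + 1))).mixFF 0 κ (u : Site (3 + 1)) ρ (translate M' (w : Site (3 + 1)) n) x z a c)) X Z) := by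
  obtain ⟨δG, CG, hδG, -, hG⟩ := decays_AN_family R j 0
  obtain ⟨Cm, δm, hδm, hM₂⟩ := exists_locStencilFM_M2N R P j (one_le_of_neZero Lc) 0
  exact perF_mixOfK_cs_per M hM (translate_inv_AN R j M hM) (by rw [AN_eq]; exact hG) hδG (periodCov_M2N R P j M (one_le_of_neZero Lc) hM) hM₂ hδm μ y ν y' X Z

/-- [folklore] **THE RESPONSE WORD AT THE N RECORD**: `perF M (dM (K2OfK K N S^per Mt^per ν y′) N S^per Mt^per μ y) P Q
= Σ_{u,κ} (−(Â·D̂_{νy′}·Â))((u, inl κ),(wrapPt M (N•y), inr μ)) · perF M (S^per κ u) P Q + Σ_{w,ρ} (−(Â·D̂_{νy′}·Â))((wrapPt M (N•w), inr ρ),(wrapPt M (N•y), inr μ)) · perF M (Mt^per ρ w) P Q`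
(`CombHId2TorusWords.perF_dM_K2OfK_dper_apply`). -/
theorem perF_resp_N (hM : ∀ i, M i = Lc ^ (j + 1) * M' i) (μ : Fin (3 + 1)) (y : Site (3 + 1)) (ν : Fin (3 + 1)) (y' : Site (3 + 1)) (X Z : Idx M (Fib 3)) :
    perF M (dM (K2OfK (AN R j) (Lc ^ (j + 1)) (fun κ u => dper M (SpureRecOf 3 (Lc ^ (j + 1)) (tabsComp (j + 1) (one_le_of_neZero Lc) R.hr (P.cM (j + 1))).V
              (tabsComp (j + 1) (one_le_of_neZero Lc) R.hr (P.cM (j + 1))).H (fun _ => compChart R.rc Lc (j + 1) (R.s (j + 1)) (Lc ^ (j + 1)))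
              (P.cE (j + 1)) (P.cVH (j + 1)) (P.cΛ (j + 1)) 0 κ u)) (fun ρ w => dper M ((tabsComp (j + 1) (one_le_of_neZero Lc) R.hr (P.cM (j + 1))).M 0 ρ w)) ν y') (Lc ^ (j + 1))
        (fun κ u => dper M (SpureRecOf 3 (Lc ^ (j + 1)) (tabsComp (j + 1) (one_le_of_neZero Lc) R.hr (P.cM (j + 1))).V
              (tabsComp (j + 1) (one_le_of_neZero Lc) R.hr (P.cM (j + 1))).H (fun _ => compChart R.rc Lc (j + 1) (R.s (j + 1)) (Lc ^ (j + 1)))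
              (P.cE (j + 1)) (P.cVH (j + 1)) (P.cΛ (j + 1)) 0 κ u)) (fun ρ w => dper M ((tabsComp (j + 1) (one_le_of_neZero Lc) R.hr (P.cM (j + 1))).M 0 ρ w)) μ y) X Z
      = ∑ u : ↥(pbox M), ∑ κ : Fin (3 + 1),
            (-(perF M (AN R j)
                * perF M (dM (AN R j) (Lc ^ (j + 1)) (fun κ u => dper M (SpureRecOf 3 (Lc ^ (j + 1)) (tabsComp (j + 1) (one_le_of_neZero Lc) R.hr (P.cM (j + 1))).V
              (tabsComp (j + 1) (one_le_of_neZero Lc) R.hr (P.cM (j + 1))).H (fun _ => compChart R.rc Lc (j + 1) (R.s (j + 1)) (Lc ^ (j + 1)))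
              (P.cE (j + 1)) (P.cVH (j + 1)) (P.cΛ (j + 1)) 0 κ u)) (fun ρ w => dper M ((tabsComp (j + 1) (one_le_of_neZero Lc) R.hr (P.cM (j + 1))).M 0 ρ w)) ν y')
                * perF M (AN R j)))
                (u, Sum.inl κ) (wrapPt M (((Lc ^ (j + 1) : ℕ) : ℤ) • y), Sum.inr μ) * perF M (dper M (SpureRecOf 3 (Lc ^ (j + 1)) (tabsComp (j + 1) (one_le_of_neZero Lc) R.hr (P.cM (j + 1))).V
              (tabsComp (j + 1) (one_le_of_neZero Lc) R.hr (P.cM (j + 1))).H (fun _ => compChart R.rc Lc (j + 1) (R.s (j + 1)) (Lc ^ (j + 1)))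
              (P.cE (j + 1)) (P.cVH (j + 1)) (P.cΛ (j + 1)) 0 κ (u : Site (3 + 1)))) X Z
        + ∑ w : ↥(pbox M'), ∑ ρ : Fin (3 + 1),
            (-(perF M (AN R j)
                * perF M (dM (AN R j) (Lc ^ (j + 1)) (fun κ u => dper M (SpureRecOf 3 (Lc ^ (j + 1)) (tabsComp (j + 1) (one_le_of_neZero Lc) R.hr (P.cM (j + 1))).V
              (tabsComp (j + 1) (one_le_of_neZero Lc) R.hr (P.cM (j + 1))).H (fun _ => compChart R.rc Lc (j + 1) (R.s (j + 1)) (Lc ^ (j + 1)))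
              (P.cE (j + 1)) (P.cVH (j + 1)) (P.cΛ (j + 1)) 0 κ u)) (fun ρ w => dper M ((tabsComp (j + 1) (one_le_of_neZero Lc) R.hr (P.cM (j + 1))).M 0 ρ w)) ν y')
                * perF M (AN R j)))
                (wrapPt M (((Lc ^ (j + 1) : ℕ) : ℤ) • (w : Site (3 + 1))), Sum.inr ρ) (wrapPt M (((Lc ^ (j + 1) : ℕ) : ℤ) • y), Sum.inr μ)
              * perF M (dper M ((tabsComp (j + 1) (one_le_of_neZero Lc) R.hr (P.cM (j + 1))).M 0 ρ (w : Site (3 + 1)))) X Z := by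
  obtain ⟨δG, CG, hδG, -, hG⟩ := decays_AN_family R j 0
  obtain ⟨CS, δS, hδS, hS⟩ := exists_locStencil_SN R P j 0
  obtain ⟨CM, δM, hδM, hMloc⟩ := (tabsComp (j + 1) (one_le_of_neZero Lc) R.hr (P.cM (j + 1))).hM 0
  exact perF_dM_K2OfK_dper_apply M hM (translate_inv_AN R j M hM) (by rw [AN_eq]; exact hG) hδG (periodCov_SN R P j M hM) hS hδS
    (periodCov_MtN R P j M (one_le_of_neZero Lc) hM) hMloc hδM μ y ν y' X Z

end Torus

end Summit.QuantumFields.BalabanUV.Beta.NVertexWoundTorus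

end
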